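import Summits.CriticalPhenomena.PercolationContinuityZ3.Theorems.PercNearOneGluingNoHeavyLowerTailIncStarC5MidChord
import Summits.CriticalPhenomena.PercolationContinuityZ3.Theorems.PercNearOneGluingNoHeavyLowerTailIncStarCutVertex
import HarnessLib

/-!
# The increasing star from the chord of `C5` along NON-ROOT pairs at the covariance-slot target (Sahi programme, prover prim-sahi-p2 gen 41)

Support file (`--supports stmt-CriticalPhenomena-4575`, helper).  No definitions, no named facts, no sorries; standard axioms.
Memo `run/shared/lean/prim/prim-sahi/FROM-prim-sahi-p2-gen41-CHORD-AT-B.md`, ADDENDUM A (A2); `prim-sahi-p2/PROOF-E3.md` §51.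

`…IncStarC5MidChord` reduces the C5 family (hence the increasing star) to the chord inequality of `C5(P; s; a; b, c)` along the fractional pairs
`s(b,y)` at the covariance-slot target `b`, for EVERY `y`.  Here the pairs with `y = s` (root–b) are REMOVED from the hypothesis: in the induction, `b` is
moved inside its weight-`1` class `U` to a carrier of a fractional pair `s(u,y)` with `y ≠ s` whenever one exists; otherwise every pair leaving `U` towards a
vertex other than the root has weight `0`, the root is a cut vertex between `U ∪ {s}` and `Uᶜ` on almost every configuration, and the form VANISHES:
`{s↔b}` is (a.s.) determined by the pairs inside `U ∪ {s}`, `{s↔a}`, `{s↔c}` by the off-diagonal pairs inside `Uᶜ` (`IncStarCutVertex.openConnIn_union_iff_of_mem_left/right`),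
and the two families are independent (`prodBernoulli_real_inter_of_determinedBy`) — `c5_eq_zero_of_rootHanging`; if `a` or `c` lies in `U` the form is one of the
two explicit nonnegative degenerate forms `c5_nonneg_of_mid_eq_dist` / `c5_nonneg_of_mid_eq_third`.

* `c5_nonneg_of_midPairStep'` — the C5 family from one step along a fractional pair `s(b,y)`, `y ∉ {b, s}`;
* `c5_nonneg_of_midChord'`, **`incStar_of_midChord'`**, `incStarPlus_of_midChord'` — C5, the increasing star and ISTAR⁺ on every finite weighted graph from the
  chord inequality along the NON-ROOT pairs at `b` (CONJECTURE BCL′ of the memo: the classes T_a–T_b, T_b–T_c, T_b–U, which are three-copy positive on K₄ and K₅;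
  the root–b class, not needed here, is NOT three-copy positive on K₅).

Nothing in this file asserts BCL′.
-/

noncomputable section

namespace Summit.CriticalPhenomena.PercolationContinuityZ3.Theorems

namespace IncStar

open MeasureTheory Set Literature.Probability.Percolation Literature.Probability.LatticeModels EdgeInduction
open Literature.Probability.Percolation.BlockExploration (mem_openConn_iff_openConnIn_univ)
open scoped Classical

variable {n : ℕ}

/-! ### Two degenerate forms -/

/-- `C5(a; a, c) ≥ 0`: `2P(A∩A∩C) + P(A)²P(C) − 3P(A)P(A∩C) ≥ 0` for a probability measure with `P(A)P(C) ≤ P(A∩C)` (Harris). [this work] -/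
theorem c5_nonneg_of_mid_eq_dist {Ω : Type*} [MeasurableSpace Ω] (μ : Measure Ω) [IsProbabilityMeasure μ] (A C : Set Ω)
    (hH : μ.real A * μ.real C ≤ μ.real (A ∩ C)) :
    0 ≤ 2 * μ.real (A ∩ A ∩ C) + μ.real A * μ.real A * μ.real C - μ.real A * μ.real (A ∩ C) - 2 * (μ.real A * μ.real (A ∩ C)) := by
  rw [Set.inter_self]
  have hA0 : 0 ≤ μ.real A := measureReal_nonneg
  have hC0 : 0 ≤ μ.real C := measureReal_nonneg
  have hA1 : μ.real A ≤ 1 := by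
    have h := measureReal_mono (μ := μ) (Set.subset_univ A) (measure_ne_top _ _)
    rwa [probReal_univ] at h
  have hXC : μ.real (A ∩ C) ≤ μ.real C := measureReal_mono Set.inter_subset_right (measure_ne_top _ _)
  by_cases h : 3 * μ.real A ≤ 2
  · nlinarith [mul_nonneg (by linarith : 0 ≤ 2 - 3 * μ.real A) (sub_nonneg.2 hH), mul_nonneg hA0 hC0, mul_nonneg (mul_nonneg hA0 hC0) (by linarith : 0 ≤ 1 - μ.real A)]
  · push Not at h
    nlinarith [mul_nonneg (by linarith : 0 ≤ 3 * μ.real A - 2) (sub_nonneg.2 hXC), mul_nonneg hC0 (by linarith : 0 ≤ 1 - μ.real A),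
      mul_nonneg (mul_nonneg hC0 (by linarith : 0 ≤ 1 - μ.real A)) (by linarith : 0 ≤ 2 - μ.real A)]

/-- `C5(a; c, c) ≥ 0`: `2P(A∩C∩C) + P(A)P(C)² − P(A)P(C∩C) − 2P(C)P(A∩C) = (1 − P(C))(2P(A∩C) − P(A)P(C)) ≥ 0` (Harris). [this work] -/
theorem c5_nonneg_of_mid_eq_third {Ω : Type*} [MeasurableSpace Ω] (μ : Measure Ω) [IsProbabilityMeasure μ] (A C : Set Ω)
    (hH : μ.real A * μ.real C ≤ μ.real (A ∩ C)) :
    0 ≤ 2 * μ.real (A ∩ C ∩ C) + μ.real A * μ.real C * μ.real C - μ.real A * μ.real (C ∩ C) - 2 * (μ.real C * μ.real (A ∩ C)) := by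
  rw [Set.inter_assoc, Set.inter_self]
  have hA0 : 0 ≤ μ.real A := measureReal_nonneg
  have hC0 : 0 ≤ μ.real C := measureReal_nonneg
  have hC1 : μ.real C ≤ 1 := by
    have h := measureReal_mono (μ := μ) (Set.subset_univ C) (measure_ne_top _ _)
    rwa [probReal_univ] at h
  have hX0 : 0 ≤ μ.real (A ∩ C) := measureReal_nonneg
  nlinarith [mul_nonneg (by linarith : 0 ≤ 1 - μ.real C) (sub_nonneg.2 hH), mul_nonneg (by linarith : 0 ≤ 1 - μ.real C) hX0]

/-! ### A weight-1 class hanging off the root: the form vanishes -/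

/-- The configurations in which some weight-`0` pair is open form a null set. [folklore] -/
theorem measure_exists_weightZero_mem_eq_zero (v : Sym2 (Fin n) → unitInterval) :
    prodBernoulli v {ω : BondConfig (Fin n) | ∃ e, v e = 0 ∧ e ∈ ω} = 0 := by
  have hsub : {ω : BondConfig (Fin n) | ∃ e, v e = 0 ∧ e ∈ ω} ⊆
      ⋃ e ∈ (Finset.univ.filter fun e : Sym2 (Fin n) => v e = 0), {ω : BondConfig (Fin n) | e ∈ ω} := by
    rintro ω ⟨e, he, hmem⟩
    simp only [Set.mem_iUnion, Finset.mem_filter, Finset.mem_univ, true_and, Set.mem_setOf_eq]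
    exact ⟨e, he, hmem⟩
  have hreal : (prodBernoulli v).real (⋃ e ∈ (Finset.univ.filter fun e : Sym2 (Fin n) => v e = 0), {ω : BondConfig (Fin n) | e ∈ ω}) = 0 := by
    apply le_antisymm _ measureReal_nonneg
    refine (measureReal_biUnion_finset_le _ _).trans (le_of_eq ?_)
    exact Finset.sum_eq_zero fun e he => FrontierDecRows.real_setOf_mem_eq_zero v (Finset.mem_filter.1 he).2
  exact measure_mono_null hsub ((measureReal_eq_zero_iff (measure_ne_top _ _)).1 hreal)

/-- Two events that agree outside a null set have the same probability. [folklore] -/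
theorem real_congr_of_agree_off_null (v : Sym2 (Fin n) → unitInterval) {N S T : Set (BondConfig (Fin n))} (hN : prodBernoulli v N = 0)
    (h : ∀ ω, ω ∉ N → (ω ∈ S ↔ ω ∈ T)) : (prodBernoulli v).real S = (prodBernoulli v).real T := by
  apply measureReal_congr
  rw [Filter.eventuallyEq_set, ae_iff]
  refine measure_mono_null (fun ω hω => ?_) hN
  by_contra hωN
  exact hω (h ω hωN)

/-- **A class hanging off the root makes the form vanish.**  If `U ∌ s` contains `b` but neither `a` nor `c`, and every pair joining `U` to a vertex outside
`U ∪ {s}` has weight `0`, then `C5(P_v; s; a; b, c) = 0`: the root is (a.s.) a cut vertex between `U ∪ {s}` and `Uᶜ`, `{s↔b}` is independent of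
`({s↔a}, {s↔c})`. [this work] -/
theorem c5_eq_zero_of_rootHanging (v : Sym2 (Fin n) → unitInterval) (U : Set (Fin n)) {s a b c : Fin n}
    (hs : s ∉ U) (hb : b ∈ U) (ha : a ∉ U) (hc : c ∉ U)
    (hU : ∀ x y : Fin n, x ∉ U → y ∈ U → x ≠ s → v s(x, y) = 0) :
    let μ := prodBernoulli v
    2 * μ.real (openConn s a ∩ openConn s b ∩ openConn s c) + μ.real (openConn s a) * μ.real (openConn s b) * μ.real (openConn s c)
        - μ.real (openConn s a) * μ.real (openConn s b ∩ openConn s c) - 2 * (μ.real (openConn s b) * μ.real (openConn s a ∩ openConn s c)) = 0 := by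
  intro μ
  -- the two sides of the cut vertex `s`
  set V₁ : Set (Fin n) := Uᶜ with hV₁
  set V₂ : Set (Fin n) := insert s U with hV₂
  have hV : ∀ x, x ∈ V₁ → x ∈ V₂ → x = s := by
    intro x hx₁ hx₂
    rcases (Set.mem_insert_iff.1 hx₂) with h | h
    · exact h
    · exact absurd h hx₁
  have hs₁ : s ∈ V₁ := hs
  have hs₂ : s ∈ V₂ := Set.mem_insert s U
  have ha₁ : a ∈ V₁ := ha
  have hc₁ : c ∈ V₁ := hc
  have hb₂ : b ∈ V₂ := Set.mem_insert_of_mem s hb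
  have hunion : V₁ ∪ V₂ = Set.univ := by
    ext x
    simp only [Set.mem_union, Set.mem_univ, iff_true, hV₁, hV₂, Set.mem_compl_iff, Set.mem_insert_iff]
    by_cases hx : x ∈ U
    · exact Or.inr (Or.inr hx)
    · exact Or.inl hx
  -- the null set: some weight-0 pair open
  set N : Set (BondConfig (Fin n)) := {ω | ∃ e, v e = 0 ∧ e ∈ ω} with hN
  have hN0 : μ N = 0 := measure_exists_weightZero_mem_eq_zero v
  have hω : ∀ ω : BondConfig (Fin n), ω ∉ N → ∀ x y : Fin n, x ∈ V₁ → y ∈ V₂ → x ≠ s → y ≠ s → s(x, y) ∉ ω := by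
    intro ω hωN x y hx hy hxs hys hmem
    have hyU : y ∈ U := by
      rcases (Set.mem_insert_iff.1 hy) with h | h
      · exact absurd h hys
      · exact h
    exact hωN ⟨s(x, y), hU x y hx hyU hxs, hmem⟩
  -- agreement of the events with their one-sided forms off `N`
  have agree₁ : ∀ t : Fin n, t ∈ V₁ → ∀ ω, ω ∉ N → (ω ∈ openConn s t ↔ ω ∈ openConnIn V₁ s t) := by
    intro t ht ω hωN
    rw [mem_openConn_iff_openConnIn_univ, ← hunion]
    exact IncStarCutVertex.openConnIn_union_iff_of_mem_left hV hs₁ hs₂ (hω ω hωN) hs₁ ht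
  have agreeB : ∀ ω, ω ∉ N → (ω ∈ openConn s b ↔ ω ∈ openConnIn V₂ s b) := by
    intro ω hωN
    rw [mem_openConn_iff_openConnIn_univ, ← hunion, IncStarCutVertex.openConnIn_union_iff_of_mem_right hV hs₁ hs₂ (hω ω hωN) hs₁ hb₂]
    have hss : ω ∈ openConnIn V₁ s s := ⟨hs₁, hs₁, SimpleGraph.Reachable.refl _⟩
    exact ⟨fun h => h.2, fun h => ⟨hss, h⟩⟩
  -- the five probabilities in one-sided form
  set A₁ : Set (BondConfig (Fin n)) := openConnIn V₁ s a
  set C₁ : Set (BondConfig (Fin n)) := openConnIn V₁ s c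
  set B₂ : Set (BondConfig (Fin n)) := openConnIn V₂ s b
  have eABC : μ.real (openConn s a ∩ openConn s b ∩ openConn s c) = μ.real ((A₁ ∩ C₁) ∩ B₂) :=
    real_congr_of_agree_off_null v hN0 fun ω hωN => by
      simp only [Set.mem_inter_iff, agree₁ a ha₁ ω hωN, agree₁ c hc₁ ω hωN, agreeB ω hωN]; tauto
  have eBC : μ.real (openConn s b ∩ openConn s c) = μ.real (C₁ ∩ B₂) :=
    real_congr_of_agree_off_null v hN0 fun ω hωN => by
      simp only [Set.mem_inter_iff, agree₁ c hc₁ ω hωN, agreeB ω hωN]; tauto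
  have eB : μ.real (openConn s b) = μ.real B₂ := real_congr_of_agree_off_null v hN0 fun ω hωN => agreeB ω hωN
  have eAC : μ.real (openConn s a ∩ openConn s c) = μ.real (A₁ ∩ C₁) :=
    real_congr_of_agree_off_null v hN0 fun ω hωN => by
      simp only [Set.mem_inter_iff, agree₁ a ha₁ ω hωN, agree₁ c hc₁ ω hωN]; exact Iff.rfl
  have eC : μ.real (openConn s c) = μ.real C₁ := real_congr_of_agree_off_null v hN0 fun ω hωN => agree₁ c hc₁ ω hωN
  -- independence across the cut vertex: off-diagonal pairs inside `V₁` versus the rest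
  set F : Finset (Sym2 (Fin n)) := Finset.univ.filter fun z : Sym2 (Fin n) => ¬ z.IsDiag ∧ ∀ x ∈ z, x ∈ V₁ with hF
  have hFcoe : (↑F : Set (Sym2 (Fin n))) = {z : Sym2 (Fin n) | ¬ z.IsDiag ∧ ∀ x ∈ z, x ∈ V₁} := by
    ext z; simp [hF]
  have hdet₁ : ∀ x : Fin n, DeterminedBy (openConnIn V₁ s x : Set (BondConfig (Fin n))) (↑F : Set (Sym2 (Fin n))) := by
    intro x; rw [hFcoe]; exact IncStarCutVertex.determinedBy_openConnIn_offDiag V₁ s x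
  have hdet₂ : DeterminedBy (B₂ : Set (BondConfig (Fin n))) (↑F : Set (Sym2 (Fin n)))ᶜ := by
    refine (IncStarCutVertex.determinedBy_openConnIn_offDiag V₂ s b).mono fun z hz hzF => ?_
    rw [hFcoe] at hzF
    obtain ⟨hnd, hz₂⟩ := hz
    obtain ⟨-, hz₁⟩ := hzF
    revert hnd hz₁ hz₂
    refine Sym2.inductionOn z fun p q => ?_
    intro hnd hz₂ hz₁
    have hp : p = s := hV p (hz₁ p (Sym2.mem_mk_left p q)) (hz₂ p (Sym2.mem_mk_left p q))
    have hq : q = s := hV q (hz₁ q (Sym2.mem_mk_right p q)) (hz₂ q (Sym2.mem_mk_right p q))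
    exact hnd (by rw [Sym2.mk_isDiag_iff, hp, hq])
  have hm : ∀ X : Set (BondConfig (Fin n)), MeasurableSet X := fun _ => MeasurableSet.of_discrete
  have iABC : μ.real ((A₁ ∩ C₁) ∩ B₂) = μ.real (A₁ ∩ C₁) * μ.real B₂ :=
    prodBernoulli_real_inter_of_determinedBy v F ((hdet₁ a).inter (hdet₁ c)) hdet₂ (hm _) (hm _)
  have iBC : μ.real (C₁ ∩ B₂) = μ.real C₁ * μ.real B₂ :=
    prodBernoulli_real_inter_of_determinedBy v F (hdet₁ c) hdet₂ (hm _) (hm _)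
  rw [eABC, eBC, eB, eAC, eC, iABC, iBC]
  ring

/-! ### The schema without root–b pairs -/

/-- **THE C5 FAMILY FROM ONE STEP ALONG A NON-ROOT PAIR AT THE COVARIANCE-SLOT TARGET.**  Suppose that for every weight, every marking and every
fractional pair `s(b,y)` with `y ≠ b`, `y ≠ s` — granted `C5 ≥ 0` for fewer fractional pairs — the form `C5(P_w; s; a; b, c)` is nonnegative.  Then it is
nonnegative on every finite weighted graph. [this work] -/
theorem c5_nonneg_of_midPairStep'
    (hStep : ∀ (v : Sym2 (Fin n) → unitInterval) (s a b y c : Fin n), b ≠ y → y ≠ s → s(b, y) ∈ fracEdges v →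
      (∀ v' : Sym2 (Fin n) → unitInterval, (fracEdges v').card < (fracEdges v).card → ∀ s' a' b' c' : Fin n,
          let μ := prodBernoulli v'
          0 ≤ 2 * μ.real (openConn s' a' ∩ openConn s' b' ∩ openConn s' c') + μ.real (openConn s' a') * μ.real (openConn s' b') * μ.real (openConn s' c')
                - μ.real (openConn s' a') * μ.real (openConn s' b' ∩ openConn s' c') - 2 * (μ.real (openConn s' b') * μ.real (openConn s' a' ∩ openConn s' c'))) →
      let μ := prodBernoulli v
      0 ≤ 2 * μ.real (openConn s a ∩ openConn s b ∩ openConn s c) + μ.real (openConn s a) * μ.real (openConn s b) * μ.real (openConn s c)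
            - μ.real (openConn s a) * μ.real (openConn s b ∩ openConn s c) - 2 * (μ.real (openConn s b) * μ.real (openConn s a ∩ openConn s c))) :
    ∀ (w : Sym2 (Fin n) → unitInterval) (s a b c : Fin n),
      let μ := prodBernoulli w
      0 ≤ 2 * μ.real (openConn s a ∩ openConn s b ∩ openConn s c) + μ.real (openConn s a) * μ.real (openConn s b) * μ.real (openConn s c)
            - μ.real (openConn s a) * μ.real (openConn s b ∩ openConn s c) - 2 * (μ.real (openConn s b) * μ.real (openConn s a ∩ openConn s c)) := by
  suffices H : ∀ (k : ℕ) (v : Sym2 (Fin n) → unitInterval), (fracEdges v).card ≤ k → ∀ s a b c : Fin n,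
      let μ := prodBernoulli v
      0 ≤ 2 * μ.real (openConn s a ∩ openConn s b ∩ openConn s c) + μ.real (openConn s a) * μ.real (openConn s b) * μ.real (openConn s c)
            - μ.real (openConn s a) * μ.real (openConn s b ∩ openConn s c) - 2 * (μ.real (openConn s b) * μ.real (openConn s a ∩ openConn s c)) from
    fun w s a b c => H _ w le_rfl s a b c
  intro k
  induction k with
  | zero =>
      intro v hk s a b c
      have hv : ∀ e, v e = 0 ∨ v e = 1 := fun e => eq_zero_or_one_of_not_mem_fracEdges fun he => by
        have : 0 < (fracEdges v).card := Finset.card_pos.2 ⟨e, he⟩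
        omega
      simp only
      rw [real_eq_ite_of_zeroOne v hv (openConn s a ∩ openConn s b ∩ openConn s c), real_eq_ite_of_zeroOne v hv (openConn s a),
        real_eq_ite_of_zeroOne v hv (openConn s b), real_eq_ite_of_zeroOne v hv (openConn s c), real_eq_ite_of_zeroOne v hv (openConn s b ∩ openConn s c),
        real_eq_ite_of_zeroOne v hv (openConn s a ∩ openConn s c)]
      simp only [Set.mem_inter_iff]
      by_cases hA : {e | v e = 1} ∈ openConn s a <;> by_cases hB : {e | v e = 1} ∈ openConn s b <;>
        by_cases hC : {e | v e = 1} ∈ openConn s c <;> norm_num [hA, hB, hC]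
  | succ k ih =>
      intro v hk s a b c
      have IH : ∀ v' : Sym2 (Fin n) → unitInterval, (fracEdges v').card < (fracEdges v).card → ∀ s' a' b' c' : Fin n,
          let μ := prodBernoulli v'
          0 ≤ 2 * μ.real (openConn s' a' ∩ openConn s' b' ∩ openConn s' c') + μ.real (openConn s' a') * μ.real (openConn s' b') * μ.real (openConn s' c')
                - μ.real (openConn s' a') * μ.real (openConn s' b' ∩ openConn s' c') - 2 * (μ.real (openConn s' b') * μ.real (openConn s' a' ∩ openConn s' c')) :=
        fun v' hv' s' a' b' c' => ih v' (by omega) s' a' b' c'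
      -- (0) a fractional loop is switched off
      by_cases hloop : ∃ g ∈ fracEdges v, g.IsDiag
      · obtain ⟨g, hg, hgd⟩ := hloop
        have e := c5_update_diag_zero v hgd s a b c
        simp only at e ⊢
        rw [← e]
        exact IH _ (card_fracEdges_update_lt' v hg 0 (Or.inl rfl)) s a b c
      push Not at hloop
      set W1 : SimpleGraph (Fin n) := SimpleGraph.fromRel fun x y : Fin n => v s(x, y) = 1 with hW1
      -- (i) some vertex of the class of `b` carries a fractional pair towards a NON-ROOT vertex: move `b` there and step
      by_cases hfrac : ∃ u y : Fin n, W1.Reachable b u ∧ u ≠ y ∧ y ≠ s ∧ s(u, y) ∈ fracEdges v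
      · obtain ⟨u, y, hbu, huy, hys, hg⟩ := hfrac
        obtain ⟨p⟩ := hbu
        have e := c5_eq_of_weightOneWalk_mid v s a c p
        simp only at e ⊢
        rw [e]
        exact hStep v s a u y c huy hys hg IH
      push Not at hfrac
      -- (ii) the root lies in the class of `b`: the form vanishes identically
      by_cases hroot : W1.Reachable b s
      · obtain ⟨p⟩ := hroot
        have e := c5_eq_of_weightOneWalk_mid v s a c p
        simp only at e ⊢
        rw [e, v1362_openConn_self, Set.inter_univ, Set.univ_inter, probReal_univ]
        have h0 : 2 * (prodBernoulli v).real (openConn s a ∩ openConn s c) + (prodBernoulli v).real (openConn s a) * 1 * (prodBernoulli v).real (openConn s c)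
            - (prodBernoulli v).real (openConn s a) * (prodBernoulli v).real (openConn s c)
            - 2 * (1 * (prodBernoulli v).real (openConn s a ∩ openConn s c)) = 0 := by ring
        rw [h0]
      -- (iii) otherwise the class `U` of `b` hangs off the root only: pairs from `U` to vertices outside `U ∪ {s}` have weight 0
      · set U : Set (Fin n) := {x | W1.Reachable b x} with hUdef
        have hU : ∀ x y : Fin n, x ∉ U → y ∈ U → x ≠ s → v s(x, y) = 0 := by
          intro x y hx hy hxs
          simp only [hUdef, Set.mem_setOf_eq] at hx hy
          have hyx : y ≠ x := by rintro rfl; exact hx hy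
          have hnf : s(y, x) ∉ fracEdges v := hfrac y x hy hyx hxs
          rcases eq_zero_or_one_of_not_mem_fracEdges hnf with h | h
          · rw [Sym2.eq_swap]; exact h
          · exact absurd (hy.trans (SimpleGraph.Adj.reachable (by rw [hW1, SimpleGraph.fromRel_adj]; exact ⟨hyx, Or.inl h⟩))) hx
        have hsU : s ∉ U := fun h => hroot h
        have hbU : b ∈ U := SimpleGraph.Reachable.refl b
        have hHarris : ∀ x y : Fin n, (prodBernoulli v).real (openConn s x) * (prodBernoulli v).real (openConn s y) ≤
            (prodBernoulli v).real (openConn s x ∩ openConn s y) := fun x y =>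
          prodBernoulli_harris v (isUpperSet_openConn (V := Fin n) s x) (isUpperSet_openConn (V := Fin n) s y) MeasurableSet.of_discrete MeasurableSet.of_discrete
        by_cases haU : a ∈ U
        · -- `a` in the class of `b`: the form is `C5(a; a, c) ≥ 0`
          obtain ⟨p⟩ := (haU : W1.Reachable b a)
          have e := c5_eq_of_weightOneWalk_mid v s a c p
          simp only at e ⊢
          rw [e]
          exact c5_nonneg_of_mid_eq_dist (prodBernoulli v) (openConn s a) (openConn s c) (hHarris a c)
        by_cases hcU : c ∈ U
        · -- `c` in the class of `b`: the form is `C5(a; c, c) ≥ 0`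
          obtain ⟨p⟩ := (hcU : W1.Reachable b c)
          have e := c5_eq_of_weightOneWalk_mid v s a c p
          simp only at e ⊢
          rw [e]
          exact c5_nonneg_of_mid_eq_third (prodBernoulli v) (openConn s a) (openConn s c) (hHarris a c)
        · -- neither: the form vanishes
          have e := c5_eq_zero_of_rootHanging v U hsU hbU haU hcU hU
          simp only at e ⊢
          rw [e]

/-- **C5 FROM THE CHORD ALONG NON-ROOT PAIRS AT b (BCL′).**  If along every fractional pair `s(b,y)` with `y ∉ {b, s}` the form lies above its chord, then
`C5(P_w; s; a; b, c) ≥ 0` on every finite weighted graph and every marking. [this work] -/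
theorem c5_nonneg_of_midChord'
    (hChord : ∀ (v : Sym2 (Fin n) → unitInterval) (s a b y c : Fin n), b ≠ y → y ≠ s → s(b, y) ∈ fracEdges v →
      let μ := prodBernoulli (Function.update v s(b, y) 0)
      let ν := prodBernoulli (Function.update v s(b, y) 1)
      let P := prodBernoulli v
      (1 - (v s(b, y) : ℝ)) * (2 * μ.real (openConn s a ∩ openConn s b ∩ openConn s c) + μ.real (openConn s a) * μ.real (openConn s b) * μ.real (openConn s c)
            - μ.real (openConn s a) * μ.real (openConn s b ∩ openConn s c) - 2 * (μ.real (openConn s b) * μ.real (openConn s a ∩ openConn s c)))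
        + (v s(b, y) : ℝ) * (2 * ν.real (openConn s a ∩ openConn s b ∩ openConn s c) + ν.real (openConn s a) * ν.real (openConn s b) * ν.real (openConn s c)
            - ν.real (openConn s a) * ν.real (openConn s b ∩ openConn s c) - 2 * (ν.real (openConn s b) * ν.real (openConn s a ∩ openConn s c)))
        ≤ 2 * P.real (openConn s a ∩ openConn s b ∩ openConn s c) + P.real (openConn s a) * P.real (openConn s b) * P.real (openConn s c)
            - P.real (openConn s a) * P.real (openConn s b ∩ openConn s c) - 2 * (P.real (openConn s b) * P.real (openConn s a ∩ openConn s c))) :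
    ∀ (w : Sym2 (Fin n) → unitInterval) (s a b c : Fin n),
      let μ := prodBernoulli w
      0 ≤ 2 * μ.real (openConn s a ∩ openConn s b ∩ openConn s c) + μ.real (openConn s a) * μ.real (openConn s b) * μ.real (openConn s c)
            - μ.real (openConn s a) * μ.real (openConn s b ∩ openConn s c) - 2 * (μ.real (openConn s b) * μ.real (openConn s a ∩ openConn s c)) := by
  refine c5_nonneg_of_midPairStep' ?_
  intro v s a b y c hby hys hg IH
  have h0 := IH (Function.update v s(b, y) 0) (card_fracEdges_update_lt' v hg 0 (Or.inl rfl)) s a b c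
  have h1 := IH (Function.update v s(b, y) 1) (card_fracEdges_update_lt' v hg 1 (Or.inr rfl)) s a b c
  have hc := hChord v s a b y c hby hys hg
  simp only at h0 h1 hc ⊢
  have hp0 : 0 ≤ (v s(b, y) : ℝ) := (v s(b, y)).2.1
  have hp1 : (v s(b, y) : ℝ) ≤ 1 := (v s(b, y)).2.2
  have hq : 0 ≤ 1 - (v s(b, y) : ℝ) := by linarith
  have t0 := mul_nonneg hq h0
  have t1 := mul_nonneg hp0 h1
  linarith [hc, t0, t1]

/-- **THE INCREASING STAR FROM BCL′** (chord of `C5` along the non-root pairs at the covariance-slot target). [this work] -/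
theorem incStar_of_midChord'
    (hChord : ∀ (v : Sym2 (Fin n) → unitInterval) (s a b y c : Fin n), b ≠ y → y ≠ s → s(b, y) ∈ fracEdges v →
      let μ := prodBernoulli (Function.update v s(b, y) 0)
      let ν := prodBernoulli (Function.update v s(b, y) 1)
      let P := prodBernoulli v
      (1 - (v s(b, y) : ℝ)) * (2 * μ.real (openConn s a ∩ openConn s b ∩ openConn s c) + μ.real (openConn s a) * μ.real (openConn s b) * μ.real (openConn s c)
            - μ.real (openConn s a) * μ.real (openConn s b ∩ openConn s c) - 2 * (μ.real (openConn s b) * μ.real (openConn s a ∩ openConn s c)))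
        + (v s(b, y) : ℝ) * (2 * ν.real (openConn s a ∩ openConn s b ∩ openConn s c) + ν.real (openConn s a) * ν.real (openConn s b) * ν.real (openConn s c)
            - ν.real (openConn s a) * ν.real (openConn s b ∩ openConn s c) - 2 * (ν.real (openConn s b) * ν.real (openConn s a ∩ openConn s c)))
        ≤ 2 * P.real (openConn s a ∩ openConn s b ∩ openConn s c) + P.real (openConn s a) * P.real (openConn s b) * P.real (openConn s c)
            - P.real (openConn s a) * P.real (openConn s b ∩ openConn s c) - 2 * (P.real (openConn s b) * P.real (openConn s a ∩ openConn s c)))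
    (w : Sym2 (Fin n) → unitInterval) (s a b c : Fin n) :
    0 ≤ sahiE3 (prodBernoulli w) (openConn s a) (openConn s b) (openConn s c) :=
  sahiE3_nonneg_of_c5 _ _ _ _ (c5_nonneg_of_midChord' hChord w s a b c) (c5_nonneg_of_midChord' hChord w s a c b)

/-- **ISTAR⁺ from BCL′.** [this work] -/
theorem incStarPlus_of_midChord'
    (hChord : ∀ (v : Sym2 (Fin n) → unitInterval) (s a b y c : Fin n), b ≠ y → y ≠ s → s(b, y) ∈ fracEdges v →
      let μ := prodBernoulli (Function.update v s(b, y) 0)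
      let ν := prodBernoulli (Function.update v s(b, y) 1)
      let P := prodBernoulli v
      (1 - (v s(b, y) : ℝ)) * (2 * μ.real (openConn s a ∩ openConn s b ∩ openConn s c) + μ.real (openConn s a) * μ.real (openConn s b) * μ.real (openConn s c)
            - μ.real (openConn s a) * μ.real (openConn s b ∩ openConn s c) - 2 * (μ.real (openConn s b) * μ.real (openConn s a ∩ openConn s c)))
        + (v s(b, y) : ℝ) * (2 * ν.real (openConn s a ∩ openConn s b ∩ openConn s c) + ν.real (openConn s a) * ν.real (openConn s b) * ν.real (openConn s c)
            - ν.real (openConn s a) * ν.real (openConn s b ∩ openConn s c) - 2 * (ν.real (openConn s b) * ν.real (openConn s a ∩ openConn s c)))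
        ≤ 2 * P.real (openConn s a ∩ openConn s b ∩ openConn s c) + P.real (openConn s a) * P.real (openConn s b) * P.real (openConn s c)
            - P.real (openConn s a) * P.real (openConn s b ∩ openConn s c) - 2 * (P.real (openConn s b) * P.real (openConn s a ∩ openConn s c)))
    (w : Sym2 (Fin n) → unitInterval) (s a b c : Fin n) :
    |(prodBernoulli w).real (openConn s b) * (prodBernoulli w).real (openConn s a ∩ openConn s c)
        - (prodBernoulli w).real (openConn s c) * (prodBernoulli w).real (openConn s a ∩ openConn s b)|
      ≤ sahiE3 (prodBernoulli w) (openConn s a) (openConn s b) (openConn s c) :=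
  abs_le_sahiE3_of_c5 _ _ _ _ (c5_nonneg_of_midChord' hChord w s a b c) (c5_nonneg_of_midChord' hChord w s a c b)

end IncStar

end Summit.CriticalPhenomena.PercolationContinuityZ3.Theorems

/-!
## Status correction (prover prim-sahi-p2 gen 41, 2026-08-29 06:3xZ) — the universal hypothesis of this file is FALSE in thin corners

The conjecture whose name appears in the hypotheses above ("BCL": the chord inequality `IC_e ≥ 0` along EVERY pair at the covariance-slot target `b`,
resp. "BCL′": along every non-root pair at `b`) was refuted by the seat's own adversarial kit search with exact re-checks (kit j324920): seven weighted graphs on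
6–8 vertices have a pair at `b` — a root–b pair, or a b–unmarked pair whose unmarked end carries a weight-`0.999999` pair to the root — with chord defect
`IC_e(actual weight)` between `−2.9·10⁻¹⁵` and `−9.6·10⁻¹¹` (against `C5 ≈ 10⁻⁴`); the random exact census (25.9 M pairs at `b`) shows none.  The theorems of this
file remain correct, and its identity / schema lemmas (`c5_chord_identity`, `c5_nonneg_of_chordStep`, `c5_nonneg_of_midPairStep[']`, `c5_eq_zero_of_rootHanging`, …)
remain the tools, but the hypotheses `hChord` / `hIC` of `incStar_of_midChord[']`, `incStar_of_midEdgeIC`, `c5_nonneg_of_midChord[']` are not satisfiable for `n ≥ 6`.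
The usable reduction is `IncStar.incStar_of_existsChord` in `…IncStarC5ExistsChord` (hypothesis: SOME fractional pair with `IC_e ≥ 0` in every weighted marking —
never violated, including the seven witnesses).  Memo `run/shared/lean/prim/prim-sahi/FROM-prim-sahi-p2-gen41-CHORD-AT-B.md`, ADDENDUM F; witnesses
`run/shared/lean/prim/prim-sahi/prim-sahi-p2/gen41/lab/BCL_thin_corner_witnesses.jsonl`.
-/
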